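import Literature.Probability.Percolation.InterfaceTraversalBoundData3
import Literature.Probability.Percolation.BondInterfaceMeasurability
import Literature.Probability.RandomPlanarGeometry.SLEConvergenceCriterion
import HarnessLib

/-!
# Multiple shell crossings by the bond interface of ARBITRARY discrete Dobrushin data, IV:
the traversal bound and tightness of the interface laws of discretisation families

Topic: Probability / Percolation. Last file of the verbatim generalisation of
`InterfaceTraversalBound.lean` / `InterfaceScalingLimitProofs.lean` (Aizenman–Burchard, Duke
Math. J. 99 (1999), Thm 1.2 and Appendix A, for the medial exploration path of critical bond
percolation on `δℤ²`) from the canonical data `dobrushinData D δ` to arbitrary discrete Dobrushin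
data `E` with `E.Ω = D.carrier`, `E.δ = δ` (see `InterfaceTraversalBoundData.lean`). Contents:

* `shortDistanceCutoff_data` — AB99 §1.a (H0), the lattice short-distance cutoff, for arbitrary
  data (copy of `bondExploration_shortDistanceCutoff_holds`);
* `traversalBound_data` — AB99 hypothesis H1 (eq. (1.3), App. A Thm A.1) with the tree's
  shell-dependent threshold, UNIFORMLY over all admissible data with domain `D` and mesh `δ`
  (copy of `bondExploration_traversalBound_holds`, through `arms_of_hasTraversals_data`);
* `isTightMeasureSet_map_bondInterfaceIn` — tightness of the interface laws
  `P_{1/2}.map (bondInterfaceIn D (E δ))`, `δ ∈ (0, δ₂]`, of any family of admissible data, by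
  the abstract criterion `isTightMeasureSet_of_traversalBounds` (AB99 Thms 1.1–1.2);
* `isTightAlongMesh_bondInterfaceIn`, `ZdDiscretisationFamily.isTightAlongMesh_bondInterfaceIn`
  — tightness along the mesh filter `𝓝[>] 0` (`IsTightAlongMesh`, the hypothesis of the
  Prokhorov-type criterion `convergesInLawToSLE_of_isTightAlongMesh`) for every family of data
  which is eventually admissible, in particular for every `ZdDiscretisationFamily`.

References: M. Aizenman, A. Burchard, Duke Math. J. 99 (1999) 419–453, Thms 1.1–1.2, §1.a,
Appendix A; F. Camia, C. M. Newman, PTRF 139 (2007), §2; S. Smirnov, C. R. Acad. Sci. Paris 333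
(2001), §2.
-/

noncomputable section

open MeasureTheory Metric Set Filter Topology
open scoped Pointwise unitInterval ENNReal

namespace Literature.Probability.Percolation

open LatticeModels LatticeModels.IsMedialExploration

/-! ### (H0): the short-distance cutoff for arbitrary data -/

/-- **(C0) for arbitrary data.** For every Dobrushin domain `D` there are a radius `r₀` and a
number `k₀` such that for every mesh `δ ∈ (0, 1]`, every discrete Dobrushin datum `E` with domain
`D` and mesh `δ` (arbitrary arcs, admissible or not) and every configuration `ω`, the medial
exploration polygon `medialExplorationCurve E ω` lies in `closedBall 0 r₀` and traverses no shell
of inner radius `ρ ≤ δ` by `k₀` separate segments (the polygon uses each medial dart at most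
once and boundedly many darts live near a ball of radius `δ`; junk constant curve otherwise).
Aizenman–Burchard's "short-distance cutoff", Duke Math. J. 99 (1999), §1.a, quantitative lattice
form; same proof as `bondExploration_shortDistanceCutoff_holds`.
[cite: AizenmanBurchardDuke1999, §1.a] -/
theorem shortDistanceCutoff_data (D : RandomPlanarGeometry.DobrushinDomain) :
    ∃ (r₀ : ℝ) (k₀ : ℕ), 0 ≤ r₀ ∧ ∀ δ ∈ Set.Ioc (0 : ℝ) 1, ∀ E : DiscreteDobrushin,
      E.Ω = D.carrier → E.δ = δ → ∀ ω : BondConfig (Site 2),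
      (⟨medialExplorationCurve E ω⟩ : RandomPlanarGeometry.Curve ℂ).range ⊆ closedBall 0 r₀ ∧
        ∀ (x : ℂ) (ρ R : ℝ), 0 < ρ → ρ ≤ δ → ρ < R →
          ¬ (⟨medialExplorationCurve E ω⟩ : RandomPlanarGeometry.Curve ℂ).HasTraversals k₀ x ρ R := by
  obtain ⟨r, hr⟩ := D.isBounded.subset_closedBall (0 : ℂ)
  refine ⟨max r 0 + 1, 2 * ((2 * 5 + 1) ^ 2 * 4 + 1) + 1, by positivity, fun δ hδ E hΩ hEδ ω ↦ ?_⟩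
  obtain ⟨hδ0, hδ1⟩ := hδ
  obtain ⟨Ω', δ', arcA, arcB⟩ := E
  dsimp only at hΩ hEδ
  subst Ω' δ'
  rw [show (⟨medialExplorationCurve ⟨D.carrier, δ, arcA, arcB⟩ ω⟩ : RandomPlanarGeometry.Curve ℂ) =
    ⟨polyline ((medialExploration ⟨D.carrier, δ, arcA, arcB⟩ ω).map (medialPoint δ))⟩ from rfl]
  rcases medialExploration_eq_nil_or ⟨D.carrier, δ, arcA, arcB⟩ ω with hnil | hexp
  · -- junk constant curve `0`
    rw [hnil, List.map_nil, polyline_nil]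
    change (RandomPlanarGeometry.Curve.const (0 : ℂ)).range ⊆ _ ∧ ∀ (x : ℂ) (ρ R : ℝ), 0 < ρ → ρ ≤ δ → ρ < R →
      ¬ (RandomPlanarGeometry.Curve.const (0 : ℂ)).HasTraversals _ x ρ R
    refine ⟨?_, fun x ρ R _ _ hρR ↦ RandomPlanarGeometry.Curve.not_hasTraversals_const _ (by omega) hρR⟩
    rintro _ ⟨t, rfl⟩
    simp only [RandomPlanarGeometry.Curve.const_apply, mem_closedBall, dist_self]
    positivity
  · -- genuine exploration path
    generalize hγ : medialExploration ⟨D.carrier, δ, arcA, arcB⟩ ω = γ at hexp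
    refine ⟨?_, fun x ρ R hρ hρδ hρR ↦ ?_⟩
    · -- the trace lies within `1` of the domain
      rcases γ with _ | ⟨a, _ | ⟨b, l⟩⟩
      · exact (hexp.ne_nil rfl).elim
      · exact (hexp.head_ne_getLast rfl).elim
      · change Set.range (polylineFrom (medialPoint δ a) ((b :: l).map (medialPoint δ))).2 ⊆ _
        have hpt : ∀ e ∈ a :: b :: l, medialPoint δ e ∈ closedBall (0 : ℂ) (max r 0 + 1) := by
          intro e he
          obtain ⟨p, hp, hep⟩ := exists_mem_zip_of_mem (a :: b :: l) (by simp) he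
          obtain ⟨v, f, hvf, hf, hs, ht⟩ := hexp.step p.1 p.2 (infix_of_mem_zip_tail _ hp)
          have hv : meshPoint δ v ∈ closedBall (0 : ℂ) r :=
            hr (meshPoint_mem_of_isCorner_of_isInnerFace hvf hf)
          have hd : dist (medialPoint δ e) (meshPoint δ v) ≤ δ := by
            rcases hep with rfl | rfl
            · rw [← hs]; exact dist_medialPoint_cornerSource_le hδ0.le hvf
            · rw [← ht]; exact dist_medialPoint_cornerTarget_le hδ0.le hvf
          rw [mem_closedBall] at hv ⊢
          linarith [dist_triangle (medialPoint δ e) (meshPoint δ v) 0, le_max_left r 0]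
        exact range_polylineFrom_subset (convex_closedBall 0 _) (hpt a (by simp))
          fun p hp ↦ by
            obtain ⟨e, he, rfl⟩ := List.mem_map.1 hp
            exact hpt e (List.mem_cons_of_mem _ he)
    · -- no `k₀` traversals of shells of inner radius `ρ ≤ δ`
      refine not_hasTraversals_polyline_of_isMedialExploration hexp hρR (nearestSite δ x) 5
        fun p hp v f hvf hf hs ht hmeet i ↦ ?_
      refine abs_sub_nearestSite_le (K := 4) hδ0 ?_ (by norm_num) i
      obtain ⟨z, hzseg, hzball⟩ := hmeet
      dsimp only at hzseg
      have h1 : dist (medialPoint δ p.1) (meshPoint δ v) ≤ δ := by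
        rw [← hs]; exact dist_medialPoint_cornerSource_le hδ0.le hvf
      have h2 : dist (medialPoint δ p.2) (meshPoint δ v) ≤ δ := by
        rw [← ht]; exact dist_medialPoint_cornerTarget_le hδ0.le hvf
      have h12 : dist (medialPoint δ p.2) (medialPoint δ p.1) ≤ 2 * δ := by
        linarith [dist_triangle (medialPoint δ p.2) (meshPoint δ v) (medialPoint δ p.1),
          dist_comm (meshPoint δ v) (medialPoint δ p.1)]
      have hz : dist z (medialPoint δ p.1) ≤ 2 * δ := by
        have hsub := (convex_closedBall (medialPoint δ p.1) (2 * δ)).segment_subset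
          (mem_closedBall_self (by positivity)) (mem_closedBall.2 h12)
        exact mem_closedBall.1 (hsub hzseg)
      rw [mem_closedBall] at hzball
      linarith [dist_triangle (meshPoint δ v) (medialPoint δ p.1) x,
        dist_triangle (medialPoint δ p.1) z x, dist_comm (medialPoint δ p.1) (meshPoint δ v),
        dist_comm z (medialPoint δ p.1)]

/-! ### (H1): the traversal bound, uniformly over the data -/

/-- **Power bound on multiple shell crossings, uniformly over admissible data** — hypothesis H1
of Aizenman–Burchard, Duke Math. J. 99 (1999), eq. (1.3) and Appendix A Thm A.1, for the medial
exploration path of critical bond percolation `P_{1/2}` on `δℤ²`, in the tree's formulation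
(`bondExploration_traversalBound`: shell-dependent threshold, small mesh), for EVERY admissible
discrete Dobrushin datum `E` with domain `D` and mesh `δ`: the threshold `k`, the constants
`K, λ` and the mesh bound `δ₀` depend on the Jordan domain `D` only (through a modulus of
uniform continuity of `∂D` and the RSW/BK constants), not on the arcs of `E`. Same proof as
`bondExploration_traversalBound_holds` (`arms_of_hasTraversals_data`, iterated BK–Reimer
`measureReal_disjointOccurrencePow_le`, one-crossing bound `annulusOpenCrossing_half_le_holds`,
self-duality `bondPercolation_map_dualConfig_holds`).
[cite: AizenmanBurchardDuke1999, §1.b (1.3) and Appendix A Thm A.1] -/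
theorem traversalBound_data (D : RandomPlanarGeometry.DobrushinDomain) :
    ∃ (k : ℂ → ℝ → ℝ → ℕ) (K lam δ₀ : ℝ), 0 ≤ K ∧ 2 < lam ∧ 0 < δ₀ ∧
      ∀ δ ∈ Set.Ioc (0 : ℝ) δ₀, ∀ E : DiscreteDobrushin, E.Ω = D.carrier → E.δ = δ →
        E.IsZdAdmissible → ∀ (x : ℂ) (ρ R : ℝ), δ ≤ ρ → ρ < R → R ≤ 1 →
          bondPercolation (zdGraph 2) half
              {ω | (⟨medialExplorationCurve E ω⟩ : RandomPlanarGeometry.Curve ℂ).HasTraversals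
                (k x ρ R) x ρ R} ≤
            ENNReal.ofReal (K * (ρ / R) ^ lam) := by
  classical
  obtain ⟨α, c₀, hα, hc₀, hone⟩ := annulusOpenCrossing_half_le_holds
  set C : ℝ := max 16 c₀ with hCdef
  have hC : (16 : ℝ) ≤ C := le_max_left _ _
  have hCc₀ : c₀ ≤ C := le_max_right _ _
  set j₀ : ℕ := ⌈3 / α⌉₊ + 1 with hj₀
  have hαj₀ : (3 : ℝ) ≤ α * j₀ := by
    have h1 : 3 / α ≤ (⌈3 / α⌉₊ : ℝ) := Nat.le_ceil _
    have h2 : (⌈3 / α⌉₊ : ℝ) ≤ (j₀ : ℝ) := by rw [hj₀]; push_cast; linarith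
    calc (3 : ℝ) = α * (3 / α) := by field_simp
      _ ≤ α * j₀ := mul_le_mul_of_nonneg_left (h1.trans h2) hα.le
  have hmodex : ∀ η : ℝ, 0 < η →
      ∃ θ : ℝ, 0 < θ ∧ ∀ s t : ℝ, |s - t| < θ → dist (D.boundary s) (D.boundary t) < η :=
    fun η hη => JordanDomain.exists_modulus D.toJordanDomain hη
  set θf : ℝ → ℝ := fun ρ => if h : 0 < ρ then (hmodex ρ h).choose else 1 with hθf
  have hθf_spec : ∀ ρ (h : 0 < ρ), 0 < θf ρ ∧
      ∀ s t : ℝ, |s - t| < θf ρ → dist (D.boundary s) (D.boundary t) < ρ := by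
    intro ρ h
    simp only [hθf, dif_pos h]
    exact (hmodex ρ h).choose_spec
  set kf : ℂ → ℝ → ℝ → ℕ := fun _ ρ _ => (2 * j₀ + ⌊1 / θf ρ⌋₊ + 2).choose 2 + 3 with hkf
  set K : ℝ := max ((16 * C) ^ (3 : ℕ)) (2 * (8 * (C + 3)) ^ (α * j₀)) with hKdef
  have hK16 : (16 * C) ^ (3 : ℕ) ≤ K := le_max_left _ _
  have hK2 : 2 * (8 * (C + 3)) ^ (α * j₀) ≤ K := le_max_right _ _
  refine ⟨kf, K, 3, 1, le_trans (by positivity) hK16, by norm_num, one_pos, ?_⟩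
  intro δ hδ E hΩ hEδ hadm x ρ R hδρ hρR hR1
  obtain ⟨Ω', δ', arcA, arcB⟩ := E
  dsimp only at hΩ hEδ
  subst Ω' δ'
  obtain ⟨hδ0, -⟩ := hδ
  have hρ : 0 < ρ := hδ0.trans_le hδρ
  have hR : 0 < R := hρ.trans hρR
  set P := bondPercolation (zdGraph 2) half with hP
  have hrpow : (ρ / R) ^ (3 : ℝ) = (ρ / R) ^ (3 : ℕ) := by
    rw [show (3 : ℝ) = ((3 : ℕ) : ℝ) by norm_num, Real.rpow_natCast]
  rw [hrpow]
  by_cases hreg : 16 * C * ρ ≤ R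
  swap
  · -- small ratio: the bound is `≥ 1`
    refine (prob_le_one).trans ?_
    rw [← ENNReal.ofReal_one]
    apply ENNReal.ofReal_le_ofReal
    push Not at hreg
    have h1 : 1 ≤ 16 * C * (ρ / R) := by
      rw [mul_div_assoc', le_div_iff₀ hR]; linarith
    calc (1 : ℝ) ≤ (16 * C * (ρ / R)) ^ (3 : ℕ) := one_le_pow₀ h1
      _ = (16 * C) ^ (3 : ℕ) * (ρ / R) ^ (3 : ℕ) := by ring
      _ ≤ K * (ρ / R) ^ (3 : ℕ) := by gcongr
  · -- the genuine estimate
    obtain ⟨hθ, hmod⟩ := hθf_spec ρ hρ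
    set r' := C * ρ + 3 * δ with hr'
    set R' := R / 4 - 3 * δ with hR'
    set A := annulusOpenCrossing x δ r' R' with hA
    set S := disjointOccurrencePow A j₀ with hS
    have hCρ : 16 * ρ ≤ C * ρ := mul_le_mul_of_nonneg_right hC hρ.le
    have hr'0 : 0 ≤ r' / R' := div_nonneg (by rw [hr']; positivity) (by rw [hR']; linarith)
    -- the event is inside `S ∪ dualConfig ⁻¹' S`
    have hsub : {ω | (⟨medialExplorationCurve ⟨D.carrier, δ, arcA, arcB⟩ ω⟩ :
        RandomPlanarGeometry.Curve ℂ).HasTraversals (kf x ρ R) x ρ R} ⊆ S ∪ dualConfig ⁻¹' S := by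
      intro ω hω
      simp only [mem_setOf_eq] at hω
      rcases medialExploration_eq_nil_or ⟨D.carrier, δ, arcA, arcB⟩ ω with hnil | hexp
      · -- junk constant curve: no traversal
        exfalso
        obtain ⟨s, t, hst, -⟩ := hω
        have hk0 : 0 < kf x ρ R := by simp [hkf]
        obtain ⟨i⟩ : Nonempty (Fin (kf x ρ R)) := Fin.pos_iff_nonempty.1 hk0
        have h := (hst i).2
        have e : ∀ u, (⟨medialExplorationCurve ⟨D.carrier, δ, arcA, arcB⟩ ω⟩ :
            RandomPlanarGeometry.Curve ℂ) u = 0 := by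
          intro u
          show medialExplorationCurve ⟨D.carrier, δ, arcA, arcB⟩ ω u = 0
          rw [medialExplorationCurve, hnil]; simp
        rw [e, e] at h
        rcases h with ⟨h1, h2⟩ | ⟨h1, h2⟩ <;> linarith
      · obtain ⟨b, l', hbl⟩ := List.exists_cons_of_ne_nil hexp.ne_nil
        rw [hbl] at hexp
        have hcurve : (⟨medialExplorationCurve ⟨D.carrier, δ, arcA, arcB⟩ ω⟩ :
            RandomPlanarGeometry.Curve ℂ) = ⟨polyline ((b :: l').map (medialPoint δ))⟩ := by
          show (⟨medialExplorationCurve ⟨D.carrier, δ, arcA, arcB⟩ ω⟩ : RandomPlanarGeometry.Curve ℂ) = _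
          rw [medialExplorationCurve, hbl]
        rw [hcurve] at hω
        rcases arms_of_hasTraversals_data hδ0 hadm hexp hδρ hC hreg hθ hmod (j₀ := j₀) (le_rfl) hω
          with h | h
        · exact Or.inl h
        · exact Or.inr h
    -- probabilities
    have hPS : P S ≤ ENNReal.ofReal ((r' / R') ^ (α * j₀)) := by
      have hloc := isLocalEvent_annulusOpenCrossing hδ0 x r' R'
      have h1 := measureReal_disjointOccurrencePow_le (zdGraph 2) half hloc j₀
      have h2 : P.real A ≤ (r' / R') ^ α := hone x δ r' R' hδ0 (by rw [hr']; nlinarith) (by rw [hr', hR']; linarith)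
      have h3 : P.real S ≤ ((r' / R') ^ α) ^ j₀ := h1.trans (pow_le_pow_left₀ measureReal_nonneg h2 j₀)
      rw [← Real.rpow_natCast, ← Real.rpow_mul hr'0] at h3
      calc P S = ENNReal.ofReal (P.real S) := (ENNReal.ofReal_toReal (measure_ne_top _ _)).symm
        _ ≤ ENNReal.ofReal ((r' / R') ^ (α * j₀)) := ENNReal.ofReal_le_ofReal h3
    have hPdual : P (dualConfig ⁻¹' S) ≤ P S := by
      calc P (dualConfig ⁻¹' S) ≤ P.map dualConfig S := Measure.le_map_apply measurable_dualConfig.aemeasurable _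
        _ = P S := by
          rw [hP, bondPercolation_map_dualConfig_holds half,
            show unitInterval.symm half = half from Subtype.ext (by simp [half]; norm_num)]
    -- the real inequality `2 (r'/R')^{αj₀} ≤ K (ρ/R)^3`
    have hratio : r' / R' ≤ 8 * (C + 3) * (ρ / R) := by
      have hR'pos : 0 < R' := by rw [hR']; linarith
      rw [div_le_iff₀ hR'pos, hr', hR']
      have : 8 * (C + 3) * (ρ / R) * (R / 4 - 3 * δ) = (C + 3) * ρ * 2 - 8 * (C + 3) * (ρ / R) * 3 * δ := by
        field_simp
        ring
      nlinarith [mul_pos hρ hR, div_nonneg hρ.le hR.le, mul_nonneg (by linarith : (0:ℝ) ≤ C + 3) (div_nonneg hρ.le hR.le)]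
    have hreal : 2 * (r' / R') ^ (α * j₀) ≤ K * (ρ / R) ^ (3 : ℕ) := by
      have hexp0 : 0 ≤ α * j₀ := by positivity
      have h1 : (r' / R') ^ (α * j₀) ≤ (8 * (C + 3) * (ρ / R)) ^ (α * j₀) :=
        Real.rpow_le_rpow hr'0 hratio hexp0
      have hρR : ρ / R ≤ 1 := (div_le_one hR).2 hρR.le
      have hρR0 : 0 ≤ ρ / R := div_nonneg hρ.le hR.le
      have h2 : (8 * (C + 3) * (ρ / R)) ^ (α * j₀) = (8 * (C + 3)) ^ (α * j₀) * (ρ / R) ^ (α * j₀) :=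
        Real.mul_rpow (by positivity) hρR0
      have h3 : (ρ / R) ^ (α * j₀) ≤ (ρ / R) ^ (3 : ℕ) := by
        rw [← Real.rpow_natCast]
        exact Real.rpow_le_rpow_of_exponent_ge (div_pos hρ hR) hρR (by push_cast; exact hαj₀)
      calc 2 * (r' / R') ^ (α * j₀) ≤ 2 * ((8 * (C + 3)) ^ (α * j₀) * (ρ / R) ^ (α * j₀)) := by rw [← h2]; linarith
        _ ≤ 2 * ((8 * (C + 3)) ^ (α * j₀) * (ρ / R) ^ (3 : ℕ)) := by gcongr
        _ = (2 * (8 * (C + 3)) ^ (α * j₀)) * (ρ / R) ^ (3 : ℕ) := by ring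
        _ ≤ K * (ρ / R) ^ (3 : ℕ) := by gcongr
    calc P {ω | (⟨medialExplorationCurve ⟨D.carrier, δ, arcA, arcB⟩ ω⟩ :
          RandomPlanarGeometry.Curve ℂ).HasTraversals (kf x ρ R) x ρ R}
        ≤ P (S ∪ dualConfig ⁻¹' S) := measure_mono hsub
      _ ≤ P S + P (dualConfig ⁻¹' S) := measure_union_le _ _
      _ ≤ ENNReal.ofReal ((r' / R') ^ (α * j₀)) + ENNReal.ofReal ((r' / R') ^ (α * j₀)) :=
          add_le_add hPS (hPdual.trans hPS)
      _ = ENNReal.ofReal (2 * (r' / R') ^ (α * j₀)) := by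
          rw [← ENNReal.ofReal_add (Real.rpow_nonneg hr'0 _) (Real.rpow_nonneg hr'0 _)]; ring_nf
      _ ≤ ENNReal.ofReal (K * (ρ / R) ^ (3 : ℕ)) := ENNReal.ofReal_le_ofReal hreal

/-! ### Tightness of the interface laws of families of data -/

/-- **Tightness of the bond interface laws near `δ = 0`, for families of admissible data**
(Aizenman–Burchard 1999, Thm 1.2): if `E δ` has domain `D`, mesh `δ` and is admissible for all
`δ ∈ (0, δ₂]`, `δ₂` below the mesh bound of `traversalBound_data` and `1`, then the laws
`P_{1/2}.map (bondInterfaceIn D (E δ))`, `δ ∈ (0, δ₂]`, form a tight set of measures on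
`CurveClass ℂ` — the abstract criterion `isTightMeasureSet_of_traversalBounds` in `E = ℂ` with
`Λ = closedBall 0 r₀`, the random curves `orientCurve D (medialExplorationCurve (E δ) ·)`
(whose classes are `bondInterfaceIn D (E δ)`; traces and traversal counts are those of the
exploration polygon, `hasTraversals_orientCurve_iff`), (H0) from `shortDistanceCutoff_data` and
(H1) from `traversalBound_data`. [cite: AizenmanBurchardDuke1999, Thm 1.2] -/
theorem isTightMeasureSet_map_bondInterfaceIn (D : RandomPlanarGeometry.DobrushinDomain) :
    ∃ δ₃ > 0, ∀ (E : ℝ → DiscreteDobrushin) (δ₂ : ℝ), δ₂ ≤ δ₃ →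
      (∀ δ, 0 < δ → δ ≤ δ₂ → (E δ).Ω = D.carrier ∧ (E δ).δ = δ ∧ (E δ).IsZdAdmissible) →
      IsTightMeasureSet
        ((fun δ ↦ (bondPercolation (zdGraph 2) half).map (bondInterfaceIn D (E δ))) '' Set.Ioc 0 δ₂) := by
  obtain ⟨r₀, k₀, hr₀, hcut⟩ := shortDistanceCutoff_data D
  obtain ⟨k, K, lam, δ₀, hK, hlam, hδ₀, hbd⟩ := traversalBound_data D
  refine ⟨min δ₀ 1, lt_min hδ₀ one_pos, fun E δ₂ hδ₂ hadm ↦ ?_⟩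
  have hT : Set.Ioc 0 δ₂ ⊆ Set.Ioc (0 : ℝ) 1 :=
    Set.Ioc_subset_Ioc_right (hδ₂.trans (min_le_right _ _))
  have hT₀ : Set.Ioc 0 δ₂ ⊆ Set.Ioc (0 : ℝ) δ₀ :=
    Set.Ioc_subset_Ioc_right (hδ₂.trans (min_le_left _ _))
  have key := RandomPlanarGeometry.isTightMeasureSet_of_traversalBounds (E := ℂ) (isCompact_closedBall (0 : ℂ) r₀)
    (C := 9 * (r₀ + 2) ^ 2) (d := 2) zero_le_two
    (fun ρ hρ hρ1 ↦ RandomPlanarGeometry.exists_finset_card_le_cover_closedBall hr₀ ρ hρ hρ1)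
    (Ω := fun _ ↦ BondConfig (Site 2)) (fun _ ↦ bondPercolation (zdGraph 2) half)
    (fun δ ω ↦ orientCurve D (medialExplorationCurve (E δ) ω))
    (fun x ρ R ↦ max k₀ (k x ρ R)) hK hlam hT ?_ ?_
  · exact key
  · -- (H0) from (C0), for every `ω`
    intro δ hδ
    obtain ⟨hΩ, hEδ, -⟩ := hadm δ hδ.1 hδ.2
    refine ae_of_all _ fun ω ↦ ⟨?_, fun x ρ R hρ hρδ hρR htr ↦ ?_⟩
    · rw [curveRange_orientCurve]
      exact (hcut δ (hT hδ) (E δ) hΩ hEδ ω).1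
    · rw [hasTraversals_orientCurve_iff] at htr
      exact (hcut δ (hT hδ) (E δ) hΩ hEδ ω).2 x ρ R hρ hρδ hρR (htr.of_le (le_max_left _ _))
  · -- (H1) from (C1)
    intro δ hδ x ρ R hδρ hρR hR1
    obtain ⟨hΩ, hEδ, had⟩ := hadm δ hδ.1 hδ.2
    refine le_trans (measure_mono fun ω hω ↦ ?_)
      (hbd δ (hT₀ hδ) (E δ) hΩ hEδ had x ρ R hδρ hρR hR1)
    simp only [mem_setOf_eq, hasTraversals_orientCurve_iff] at hω ⊢
    exact hω.of_le (le_max_right _ _)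

/-- **Tightness along the mesh of the bond interface laws of an eventually admissible family of
data** (Aizenman–Burchard 1999, Thm 1.2, in the `IsTightAlongMesh` form consumed by the
Prokhorov-type criterion `convergesInLawToSLE_of_isTightAlongMesh`): for every Dobrushin domain
`D` and every family `E δ` of discrete Dobrushin data with domain `D`, mesh `δ` and admissible for
all small `δ > 0`, the interfaces `bondInterfaceIn D (E δ)` under `P_{1/2}` are tight as
`δ → 0⁺`. Tightness being asked only eventually, the large-mesh case is not needed; measurability
of the interface is `measurable_bondInterfaceIn`. [cite: AizenmanBurchardDuke1999, Thm 1.2] -/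
theorem isTightAlongMesh_bondInterfaceIn (D : RandomPlanarGeometry.DobrushinDomain)
    (E : ℝ → DiscreteDobrushin) (hΩ : ∀ δ, (E δ).Ω = D.carrier) (hδ : ∀ δ, (E δ).δ = δ)
    (hadm : ∀ᶠ δ in 𝓝[>] (0 : ℝ), (E δ).IsZdAdmissible) :
    RandomPlanarGeometry.IsTightAlongMesh (Ωδ := fun _ ↦ BondConfig (Site 2))
      (fun δ ↦ bondInterfaceIn D (E δ)) (fun _ ↦ bondPercolation (zdGraph 2) half) := by
  obtain ⟨δ₃, hδ₃, htight⟩ := isTightMeasureSet_map_bondInterfaceIn D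
  rw [eventually_nhdsWithin_iff, Metric.eventually_nhds_iff] at hadm
  obtain ⟨ε, hε, hadm⟩ := hadm
  set δ₂ : ℝ := min (ε / 2) δ₃ with hδ₂
  have hδ₂pos : 0 < δ₂ := lt_min (by positivity) hδ₃
  refine RandomPlanarGeometry.isTightAlongMesh_of_isTightMeasureSet_image
    (Eventually.of_forall fun δ ↦ (measurable_bondInterfaceIn D (E δ)).aemeasurable) hδ₂pos
    (htight E δ₂ (min_le_right _ _) fun δ hδ0 hδle ↦ ⟨hΩ δ, hδ δ, hadm ?_ hδ0⟩)
  rw [Real.dist_eq, sub_zero, abs_of_pos hδ0]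
  exact hδle.trans_lt ((min_le_left _ _).trans_lt (by linarith))

/-- **Tightness of the interface laws of discretisation families** (Aizenman–Burchard 1999,
Thm 1.2): for every Dobrushin domain `D` and every `ZdDiscretisationFamily D E`, the bond
interfaces `bondInterfaceIn D (E δ)` under critical bond percolation are tight along the mesh
filter — the tightness hypothesis of `convergesInLawToSLE_of_isTightAlongMesh` for the open
statement `SLE6LimitZ2AllDiscretisations`. [cite: AizenmanBurchardDuke1999, Thm 1.2] -/
theorem _root_.Literature.Probability.LatticeModels.ZdDiscretisationFamily.isTightAlongMesh_bondInterfaceIn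
    {D : RandomPlanarGeometry.DobrushinDomain} {E : ℝ → DiscreteDobrushin}
    (hE : ZdDiscretisationFamily D E) :
    RandomPlanarGeometry.IsTightAlongMesh (Ωδ := fun _ ↦ BondConfig (Site 2))
      (fun δ ↦ bondInterfaceIn D (E δ)) (fun _ ↦ bondPercolation (zdGraph 2) half) :=
  Literature.Probability.Percolation.isTightAlongMesh_bondInterfaceIn D E hE.Ω_eq hE.δ_eq
    hE.eventually_isZdAdmissible

end Literature.Probability.Percolation

end
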